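import Mathlib
import Literature.MathematicalPhysics.QuantumLattice.HubbardBandSectorCountingCounts
import HarnessLib

/-!
# Four-sector counting, fold ranges: the DYADIC TOTAL at the √v-weighted (thin) tolerance `δ_s = C₀w² + C₁w√v_s` has no multiplicative `log`

Topic `Literature/MathematicalPhysics/QuantumLattice`; sub-namespace `BandSectorCounting` (continues `HubbardBandSectorCountingCounts`).  File 3 §2 of the
log-free ANISOTROPIC anchored four-sector counting lemma («E1-P2-THIN-COUNT», cell gate-hubbard-kl, plan g17 (R41); seat p4; plan HOME/prover-p4/
E1-P2-THIN-COUNT-PLAN.md §Refinement 2).  In the isotropic lemma the fold ranges are summed by `dyadic_total` at the CONSTANT tolerance `δ = C_δ·w`; the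
`Y√η/w` term of the diagonal level counts (σ near a critical point of `D(σ) = h(σ,σ)`) contributes `Y·C_δ` per dyadic level, hence `(J+1)·Y·C_δ`, which after the
`1/w` of `count_anti_total` is the second `N·log N` of Lemma F.1 (the FORWARD degeneracy seen from the fold side; Mastropietro 2008 p. 229 «γ^{−h}|h|»).  For THIN
boxes the per-σ tolerance along the anti-diagonal is (plan §Refinement 2) `δ_s := C₀·w² + C₁·w·√v_s` (`v_s = |h(σ_s, σ_s)|`; the legs' tangential widths feed the fourth
leg's level only through gradients `≍ √v_s` near the diagonal critical points), CONSTANT in `t`, so `count_anti_sigma`/`gridCount_L5` apply per `σ` verbatim, and: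

* **`fibreWidth_weighted_le`** — the per-σ width `L_s = [v_s ≤ 2δ_s] ? 2√(δ_s/c) : 2δ_s√(2M)/(c√v_s)` is
  `≤ 2w·√((C₀ + 2C₁² + C₁√(2C₀))/c) + (2√(2M)·C₁/c)·w + [iso summand at C_δ := C₀·w](s)`;
* **`dyadic_total_weighted`** — `Σ_{s∈T} L_s ≤ 8π·(2√((C₀ + 2C₁² + C₁√(2C₀))/c) + 2√(2M)C₁/c) + dyadic_total's bound at C_δ := C₀·w` — every `(J+1)` term of the latter
  carries `√(C₀w)` or `C₀w`, i.e. `(J+1)√w`-type factors (≤ 7 by p1 g4's `dyadic_level_mul_sqrt_le` on the Summits side): NO `N·log N` after the `1/w`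
  (Mastropietro (14.67) p. 223: anisotropic anchored count `≤ c·γ^{(h₀−h)/2}`, no `|h|`; Rivasseau 2002 Lemma 5: one log only on FLAT faces at half filling).

Everything is PROVED (on top of `dyadic_total`); no definitions, no named facts.

## Sources

* V. Mastropietro, *Non-Perturbative Renormalization* (2008), ch. 14 (14.67) p. 223; p. 229. [Mastropietro2008]
* G. Benfatto, A. Giuliani, V. Mastropietro, Ann. Henri Poincaré 7 (2006) 809–898, Lemma 3.1, App. A2. [BenfattoGiulianiMastropietro2006]
-/

noncomputable section

open Real Set

namespace Literature.MathematicalPhysics.QuantumLattice.BandSectorCounting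

/-- If `0 ≤ v ≤ 2(C₀w² + C₁w√v)` then `v ≤ (2C₁ + √(2C₀))²·w²` (solve the quadratic inequality in `√v`). [cite: Mastropietro2008, ch. 14 (14.67)] -/
theorem le_sq_mul_sq_of_le_weighted {v w C₀ C₁ : ℝ} (hv : 0 ≤ v) (hw : 0 ≤ w) (hC₀ : 0 ≤ C₀) (hC₁ : 0 ≤ C₁)
    (h : v ≤ 2 * (C₀ * w ^ 2 + C₁ * w * Real.sqrt v)) : v ≤ (2 * C₁ + Real.sqrt (2 * C₀)) ^ 2 * w ^ 2 := by
  set r := Real.sqrt v with hr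
  have hr0 : 0 ≤ r := Real.sqrt_nonneg _
  have hrv : r ^ 2 = v := Real.sq_sqrt hv
  have hs0 : 0 ≤ Real.sqrt (2 * C₀) := Real.sqrt_nonneg _
  have hs2 : Real.sqrt (2 * C₀) ^ 2 = 2 * C₀ := Real.sq_sqrt (by positivity)
  -- `r² ≤ 2C₀w² + 2C₁ w r` ⇒ `r ≤ C₁w + √(C₁²w² + 2C₀w²) ≤ (2C₁ + √(2C₀)) w`
  have hq : r ^ 2 ≤ 2 * C₀ * w ^ 2 + 2 * C₁ * w * r := by rw [hrv]; linarith
  have hbound : r ≤ (2 * C₁ + Real.sqrt (2 * C₀)) * w := by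
    by_contra hcon
    rw [not_le] at hcon
    have hpos : 0 < r := lt_of_le_of_lt (by positivity) hcon
    -- `r > (2C₁ + s)w` ⇒ `r² > 2C₁ w r + s w r ≥ 2C₁ w r + s w (s w) = 2C₁wr + 2C₀w²`
    have h1 : (2 * C₁ + Real.sqrt (2 * C₀)) * w * r < r * r := mul_lt_mul_of_pos_right hcon hpos
    have hsw : Real.sqrt (2 * C₀) * w ≤ r := by nlinarith [hcon, mul_nonneg hC₁ hw]
    have h2 : Real.sqrt (2 * C₀) * w * (Real.sqrt (2 * C₀) * w) ≤ Real.sqrt (2 * C₀) * w * r :=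
      mul_le_mul_of_nonneg_left hsw (by positivity)
    nlinarith [hs2, h1, h2]
  calc v = r ^ 2 := hrv.symm
    _ ≤ ((2 * C₁ + Real.sqrt (2 * C₀)) * w) ^ 2 := pow_le_pow_left₀ hr0 hbound 2
    _ = (2 * C₁ + Real.sqrt (2 * C₀)) ^ 2 * w ^ 2 := by ring

/-- **The weighted per-σ fibre width is at most (two `O(w)` terms) + (the isotropic summand at `C_δ := C₀·w`)**: with
`δ_s = C₀w² + C₁w√v_s`, `v_s ≥ 0`, `0 < w`, `0 < c`, `0 < M`,
`([v_s ≤ 2δ_s] ? 2√(δ_s/c) : 2δ_s√(2M)/(c√v_s)) ≤ 2w√((C₀ + 2C₁² + C₁√(2C₀))/c) + (2√(2M)C₁/c)·w + ([v_s ≤ 2C₀w²] ? 2√(C₀w·w/c) : 2(C₀w·w)√(2M)/(c√v_s))`.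
[cite: Mastropietro2008, ch. 14 (14.67)] -/
theorem fibreWidth_weighted_le {v w C₀ C₁ c M : ℝ} (hv : 0 ≤ v) (hw : 0 < w) (hC₀ : 0 < C₀) (hC₁ : 0 ≤ C₁) (hc : 0 < c) (hM : 0 < M) :
    (if v ≤ 2 * (C₀ * w ^ 2 + C₁ * w * Real.sqrt v) then 2 * Real.sqrt ((C₀ * w ^ 2 + C₁ * w * Real.sqrt v) / c)
      else 2 * (C₀ * w ^ 2 + C₁ * w * Real.sqrt v) * Real.sqrt (2 * M) / (c * Real.sqrt v)) ≤
      2 * w * Real.sqrt ((C₀ + 2 * C₁ ^ 2 + C₁ * Real.sqrt (2 * C₀)) / c) + 2 * Real.sqrt (2 * M) * C₁ / c * w +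
        (if v ≤ 2 * (C₀ * w * w) then 2 * Real.sqrt (C₀ * w * w / c)
          else 2 * (C₀ * w * w) * Real.sqrt (2 * M) / (c * Real.sqrt v)) := by
  have hs0 : 0 ≤ Real.sqrt (2 * C₀) := Real.sqrt_nonneg _
  have hsv : 0 ≤ Real.sqrt v := Real.sqrt_nonneg _
  have hiso0 : 0 ≤ (if v ≤ 2 * (C₀ * w * w) then 2 * Real.sqrt (C₀ * w * w / c)
      else 2 * (C₀ * w * w) * Real.sqrt (2 * M) / (c * Real.sqrt v)) := by split_ifs <;> positivity
  have hT1 : 0 ≤ 2 * w * Real.sqrt ((C₀ + 2 * C₁ ^ 2 + C₁ * Real.sqrt (2 * C₀)) / c) := by positivity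
  have hT2 : 0 ≤ 2 * Real.sqrt (2 * M) * C₁ / c * w := by positivity
  -- the small-`v` estimate, used in the first two cases
  have hsmall : v ≤ 2 * (C₀ * w ^ 2 + C₁ * w * Real.sqrt v) →
      2 * Real.sqrt ((C₀ * w ^ 2 + C₁ * w * Real.sqrt v) / c) ≤ 2 * w * Real.sqrt ((C₀ + 2 * C₁ ^ 2 + C₁ * Real.sqrt (2 * C₀)) / c) := by
    intro h1
    have hvb := le_sq_mul_sq_of_le_weighted hv hw.le hC₀.le hC₁ h1
    have hsvb : Real.sqrt v ≤ (2 * C₁ + Real.sqrt (2 * C₀)) * w := by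
      rw [← Real.sqrt_sq (by positivity : 0 ≤ (2 * C₁ + Real.sqrt (2 * C₀)) * w)]
      exact Real.sqrt_le_sqrt (by rw [mul_pow]; exact hvb)
    have hs2 : Real.sqrt (2 * C₀) ^ 2 = 2 * C₀ := Real.sq_sqrt (by positivity)
    have hδb : C₀ * w ^ 2 + C₁ * w * Real.sqrt v ≤ (C₀ + 2 * C₁ ^ 2 + C₁ * Real.sqrt (2 * C₀)) * w ^ 2 := by
      have := mul_le_mul_of_nonneg_left hsvb (by positivity : 0 ≤ C₁ * w)
      nlinarith [this]
    have hw2 : Real.sqrt (w ^ 2) = w := Real.sqrt_sq hw.le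
    rw [show 2 * w * Real.sqrt ((C₀ + 2 * C₁ ^ 2 + C₁ * Real.sqrt (2 * C₀)) / c) =
      2 * Real.sqrt (((C₀ + 2 * C₁ ^ 2 + C₁ * Real.sqrt (2 * C₀)) * w ^ 2) / c) by
        rw [mul_div_right_comm, Real.sqrt_mul' _ (sq_nonneg w), hw2]; ring]
    exact mul_le_mul_of_nonneg_left (Real.sqrt_le_sqrt (div_le_div_of_nonneg_right hδb hc.le)) (by norm_num)
  by_cases h1 : v ≤ 2 * (C₀ * w ^ 2 + C₁ * w * Real.sqrt v)
  · rw [if_pos h1]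
    have hm := hsmall h1
    by_cases h2 : v ≤ 2 * (C₀ * w * w)
    · rw [if_pos h2]
      have : 0 ≤ 2 * Real.sqrt (C₀ * w * w / c) := by positivity
      linarith
    · rw [if_neg h2]
      have : 0 ≤ 2 * (C₀ * w * w) * Real.sqrt (2 * M) / (c * Real.sqrt v) := by positivity
      linarith
  · rw [if_neg h1]
    have h1' := not_le.mp h1
    by_cases h2 : v ≤ 2 * (C₀ * w * w)
    · -- impossible: `2C₀w² ≤ 2δ_s < v ≤ 2C₀w²`
      exfalso
      have : 2 * (C₀ * w * w) ≤ 2 * (C₀ * w ^ 2 + C₁ * w * Real.sqrt v) := by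
        nlinarith [mul_nonneg (mul_nonneg hC₁ hw.le) hsv]
      linarith
    · rw [if_neg h2]
      have h2' := not_le.mp h2
      have hvpos : 0 < v := lt_of_le_of_lt (by positivity) h2'
      have hsvpos : 0 < Real.sqrt v := Real.sqrt_pos.2 hvpos
      have e : 2 * (C₀ * w ^ 2 + C₁ * w * Real.sqrt v) * Real.sqrt (2 * M) / (c * Real.sqrt v) =
          2 * (C₀ * w * w) * Real.sqrt (2 * M) / (c * Real.sqrt v) + 2 * Real.sqrt (2 * M) * C₁ / c * w := by
        field_simp
      rw [e]
      linarith [hT1]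

section Assembly

variable {a b : ℝ} (B : BandBounds a b) {μ : ℝ} (hμ : μ ∈ Icc a b)

omit B hμ in
/-- **The dyadic total at the √v-weighted tolerance** (file 3 §2 of E1-P2-THIN-COUNT): with `δ_s = C₀w² + C₁w√v_s`, `0 ≤ v_s`, the hypotheses of
`dyadic_total` (level counts `X η/w + Y√η/w + Z`, `#T ≤ 8π/w`, `w ≤ 1`, `2^J w = π`):
`Σ_{s∈T} L_s ≤ 8π·(2√((C₀ + 2C₁² + C₁√(2C₀))/c) + 2√(2M)C₁/c) + (dyadic_total's bound at C_δ := C₀·w)` — the `(J+1)` multiplies only `√(C₀w)`- and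
`C₀w`-sized terms. [cite: Mastropietro2008, ch. 14 (14.67)] -/
theorem dyadic_total_weighted {ι : Type*} (T : Finset ι) (v : ι → ℝ) {w C₀ C₁ c M X Y Z : ℝ} (hw : 0 < w) (hw1 : w ≤ 1)
    (hC₀ : 0 < C₀) (hC₁ : 0 ≤ C₁) (hc : 0 < c) (hM : 0 < M) (hX : 0 ≤ X) (hY : 0 ≤ Y) (hZ : 0 ≤ Z) {J : ℕ}
    (hJ : (2 : ℝ) ^ J * w = π) (hT : (T.card : ℝ) ≤ 8 * π / w) (hv : ∀ s, 0 ≤ v s)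
    (hlevel : ∀ η : ℝ, 0 < η → (((T.filter fun s => v s ≤ η).card : ℝ)) ≤ X * η / w + Y * Real.sqrt η / w + Z) :
    ∑ s ∈ T, (if v s ≤ 2 * (C₀ * w ^ 2 + C₁ * w * Real.sqrt (v s)) then 2 * Real.sqrt ((C₀ * w ^ 2 + C₁ * w * Real.sqrt (v s)) / c)
      else 2 * (C₀ * w ^ 2 + C₁ * w * Real.sqrt (v s)) * Real.sqrt (2 * M) / (c * Real.sqrt (v s))) ≤
      8 * π * (2 * Real.sqrt ((C₀ + 2 * C₁ ^ 2 + C₁ * Real.sqrt (2 * C₀)) / c) + 2 * Real.sqrt (2 * M) * C₁ / c) +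
      (((J : ℝ) + 1) * (2 * Real.sqrt (C₀ * w / c) * (2 * X * (C₀ * w) + Y * Real.sqrt (2 * (C₀ * w)) + Z) +
        (2 * X * (2 * (C₀ * w) * Real.sqrt (2 * M) / c) * Real.sqrt ((C₀ * w) * π) +
          Real.sqrt 2 * Y * (2 * (C₀ * w) * Real.sqrt (2 * M) / c) + Z * (2 * (C₀ * w) * Real.sqrt (2 * M) / c) / Real.sqrt (C₀ * w)) +
        8 * π * (2 * (C₀ * w) * Real.sqrt (2 * M) / c) / Real.sqrt (2 * (C₀ * w) * π))) := by
  have hiso := dyadic_total (Cδ := C₀ * w) T v hw hw1 (by positivity) hc hM hX hY hZ hJ hT hlevel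
  have hterm : ∀ s ∈ T, (if v s ≤ 2 * (C₀ * w ^ 2 + C₁ * w * Real.sqrt (v s)) then 2 * Real.sqrt ((C₀ * w ^ 2 + C₁ * w * Real.sqrt (v s)) / c)
      else 2 * (C₀ * w ^ 2 + C₁ * w * Real.sqrt (v s)) * Real.sqrt (2 * M) / (c * Real.sqrt (v s))) ≤
      (2 * w * Real.sqrt ((C₀ + 2 * C₁ ^ 2 + C₁ * Real.sqrt (2 * C₀)) / c) + 2 * Real.sqrt (2 * M) * C₁ / c * w) +
        (if v s ≤ 2 * (C₀ * w * w) then 2 * Real.sqrt (C₀ * w * w / c)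
          else 2 * (C₀ * w * w) * Real.sqrt (2 * M) / (c * Real.sqrt (v s))) := by
    intro s _
    have := fibreWidth_weighted_le (v := v s) (hv s) hw hC₀ hC₁ hc hM
    linarith
  refine (Finset.sum_le_sum hterm).trans ?_
  rw [Finset.sum_add_distrib, Finset.sum_const, nsmul_eq_mul]
  have hconst : (T.card : ℝ) * (2 * w * Real.sqrt ((C₀ + 2 * C₁ ^ 2 + C₁ * Real.sqrt (2 * C₀)) / c) + 2 * Real.sqrt (2 * M) * C₁ / c * w) ≤
      8 * π * (2 * Real.sqrt ((C₀ + 2 * C₁ ^ 2 + C₁ * Real.sqrt (2 * C₀)) / c) + 2 * Real.sqrt (2 * M) * C₁ / c) := by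
    have hTw : (T.card : ℝ) * w ≤ 8 * π := by rwa [le_div_iff₀ hw] at hT
    have h0 : 0 ≤ 2 * Real.sqrt ((C₀ + 2 * C₁ ^ 2 + C₁ * Real.sqrt (2 * C₀)) / c) + 2 * Real.sqrt (2 * M) * C₁ / c := by positivity
    calc (T.card : ℝ) * (2 * w * Real.sqrt ((C₀ + 2 * C₁ ^ 2 + C₁ * Real.sqrt (2 * C₀)) / c) + 2 * Real.sqrt (2 * M) * C₁ / c * w)
        = ((T.card : ℝ) * w) * (2 * Real.sqrt ((C₀ + 2 * C₁ ^ 2 + C₁ * Real.sqrt (2 * C₀)) / c) + 2 * Real.sqrt (2 * M) * C₁ / c) := by ring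
      _ ≤ 8 * π * (2 * Real.sqrt ((C₀ + 2 * C₁ ^ 2 + C₁ * Real.sqrt (2 * C₀)) / c) + 2 * Real.sqrt (2 * M) * C₁ / c) :=
          mul_le_mul_of_nonneg_right hTw h0
  have hiso' : ∑ s ∈ T, (if v s ≤ 2 * (C₀ * w * w) then 2 * Real.sqrt (C₀ * w * w / c)
      else 2 * (C₀ * w * w) * Real.sqrt (2 * M) / (c * Real.sqrt (v s))) ≤
      ((J : ℝ) + 1) * (2 * Real.sqrt (C₀ * w / c) * (2 * X * (C₀ * w) + Y * Real.sqrt (2 * (C₀ * w)) + Z) +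
        (2 * X * (2 * (C₀ * w) * Real.sqrt (2 * M) / c) * Real.sqrt ((C₀ * w) * π) +
          Real.sqrt 2 * Y * (2 * (C₀ * w) * Real.sqrt (2 * M) / c) + Z * (2 * (C₀ * w) * Real.sqrt (2 * M) / c) / Real.sqrt (C₀ * w)) +
        8 * π * (2 * (C₀ * w) * Real.sqrt (2 * M) / c) / Real.sqrt (2 * (C₀ * w) * π)) := by
    have e : ∀ s, (if v s ≤ 2 * (C₀ * w * w) then 2 * Real.sqrt (C₀ * w * w / c)
        else 2 * (C₀ * w * w) * Real.sqrt (2 * M) / (c * Real.sqrt (v s))) =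
        (if v s ≤ 2 * ((C₀ * w) * w) then 2 * Real.sqrt ((C₀ * w) * w / c)
        else 2 * ((C₀ * w) * w) * Real.sqrt (2 * M) / (c * Real.sqrt (v s))) := fun s => by simp only [mul_assoc]
    simpa only [e] using hiso
  linarith [hconst, hiso']

end Assembly

end Literature.MathematicalPhysics.QuantumLattice.BandSectorCounting

end
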